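import Literature.AlgebraicGeometry.GroupSchemes.FiniteGroupSchemeKernelRank
import Literature.AlgebraicGeometry.GroupSchemes.BTGroupNilpotentPoints
import Literature.AlgebraicGeometry.GroupSchemes.BarsottiTateGroupHom
import Literature.AlgebraicGeometry.GroupSchemes.BTGroupConnectedDimOneOfTangentRank
import HarnessLib

/-!
# The rank of the `ϖ`-torsion of a Barsotti–Tate group with an `𝒪`-action: `rk Γ(B[ϖ])^e = p^H` when `ϖ^e ∼ p`

Topic `Literature/AlgebraicGeometry/GroupSchemes`; namespaces `Literature.AlgebraicGeometry.GroupSchemes.AffineGroupScheme` (§1, generic) and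
`Literature.AlgebraicGeometry.GroupSchemes.BTGroup` (§2–§4).  THEOREMS ONLY (no definition, no named fact, no instance, no notation, no
`sorry`).  Cell `hodgecm-mathlib` (D-0151), FLOOR 0, P6 «MOD programme» (crux hLiu418 = stmt-HodgeConjecture-24832, `--supports`): organ
**«ϖ-TORSION RANK OF A BT GROUP WITH `𝒪`-ACTION»** = the closer-grade statement of `stub_N0_finrank_uniformizerKernel` of the P6b sub-line
`Cruxes/HLiu418/Lines/F0_P6b_BlockNumerics.lean` (desk F0P6b-plan (g2), cut of record 2026-09-01): for a Barsotti–Tate group `B` of height `H`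
over a field `k` (Tate's form ★ `BTGroup`) with a ring action `β : 𝒪 → End B` (★ `IsRingActionBT`) and an element `ϖ ∈ 𝒪` with `ϖ^e · (unit) = p`,
`e ≥ 1`, the closed subgroup `G ↪ B.G 1 = B[p]` through which exactly the `T`-points killed by `β(ϖ)` factor has `(rk_k Γ(G))^e = p^H`; hence
`rk_k Γ(G) = p^{2f}` when `H = 2·e·f` (`𝒪 = 𝒪_{F,w}`, `e` the ramification index, `f` the residue degree: `B[ϖ]` has rank `q² = (p^f)^2` for a
`w`-block of `𝒪`-height `2`).  HC_CM is proved only modulo the printed citations until rung 0 closes; this file is generic and changes no count.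

THE PRINT.  [Tate1967] §2.2 and (2.4) ∕ [HarrisTaylorAMS2001] §II.1 (p. 59): a Barsotti–Tate `𝒪`-module of height `H = d·[F_w : ℚ_p]` has
`ϖ`-torsion of rank `q^d`.  PROOF HERE (inside the layer `B[p]`, no Dieudonné theory): write `K_i := Ker (β(ϖ^i) | B[p])`; since `ϖ^e · u = p`
and `[p] = 0` on `B[p]` (★ `BTGroup.killed`), `K_e = B[p]` has rank `p^H` (★ `BTGroup.finrank_eq`); for `i + 1 ≤ e` the homomorphism
`β(ϖ) : K_{i+1} → K_i` has kernel `K_1 ≅ G` and is FAITHFULLY FLAT: a `T`-point `x` of `K_i` lifts, after the fppf cover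
`T ×_{B[p]} B[p²] → T` (base change of the faithfully flat `[p] : B[p²] → B[p]`, ★ `flat_pMap` ∕ `surjective_pMap`), to `y := β(ϖ^i · ϖ^{e-1-i} u) z`
with `p z = x`, a point of `B[p]` (because `p·y = β(ϖ^{e-1-i}u)(ϖ^i x) = 0`, ★ `isPullback_incl`) with `ϖ y = p z = x`; so `Γ(β(ϖ)|)` is
injective ([Waterhouse1979] §14.1: injective on Hopf algebras ⟺ faithfully flat, ★ `comap_injective_iff_flat_and_surjective`) and the kernel–rank
law ★ `finrank_alg_ker_mul_finrank` ([Montgomery1993Hopf] 3.2.1) gives `rk K_{i+1} = rk G · rk K_i`, whence `rk K_i = (rk G)^i` for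
`1 ≤ i ≤ e` and `(rk G)^e = p^H`.

* §1 (generic) `Alg.finrank_eq_of_iso` (`Γ`-rank is invariant under isomorphism over the base), `exists_iso_of_fac_of_fac` (two subobjects with
  mutual factorisations are isomorphic over the ambient object).
* §2 (the filtration inside `B[p]`) `kerι_powKer_comp_comp_eq_one` (`β(ϖ)` maps `K_{i+1}` into `K_i`), `exists_iso_ker_of_forall_comp_eq_one_iff`
  (a kernel with the points of `G` is isomorphic to `G`), `exists_iso_ker_powKerRestrict` (`Ker (β(ϖ) : K_{i+1} → K_i) ≅ G`).
* §3 (faithful flatness) `comap_powKerRestrict_injective` (`Γ(β(ϖ) : K_{i+1} → K_i)` is injective for `i + 1 ≤ e`).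
* §4 (ranks) `finrank_alg_powKer_eq_pow` (`rk K_{i} = (rk G)^{i}`, `1 ≤ i ≤ e`), **`finrank_alg_uniformizerKernel_pow_eq`** (`(rk G)^e = p^H`),
  **`finrank_alg_uniformizerKernel`** (`rk G = p^f · p^f` when `H = 2·e·f`).

## References
* [Tate1967] J. Tate, *p-divisible groups*, Proc. Conf. Local Fields (Driebergen 1966), Springer 1967, §2.2 and (2.4).
* [HarrisTaylorAMS2001] M. Harris, R. Taylor, *The Geometry and Cohomology of Some Simple Shimura Varieties* (2001), §II.1 (p. 59).
* [Waterhouse1979] W. Waterhouse, *Introduction to Affine Group Schemes*, GTM 66 (1979), §14.1 (faithful flatness over Hopf subalgebras).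
* [Montgomery1993Hopf] S. Montgomery, *Hopf Algebras and Their Actions on Rings*, CBMS 82 (1993), Corollary 3.2.1 (p. 30).
* [GortzWedhorn2020] U. Görtz, T. Wedhorn, *Algebraic Geometry I* (2nd ed. 2020), Definition 4.45 (2) (p. 117) (kernels), Section (4.7) (base change).
-/

set_option autoImplicit false

universe v u

open CategoryTheory Limits MonoidalCategory CartesianMonoidalCategory AlgebraicGeometry

noncomputable section

namespace Literature.AlgebraicGeometry.GroupSchemes

open Literature.AlgebraicGeometry.Motives GroupSchemeKernel AffineGroupScheme
open scoped MonObj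

/-! ## §1 Generic helpers -/

/-- **The `Γ`-rank is invariant under isomorphism over the base**: an isomorphism `X ≅ Y` of `R`-schemes induces an `R`-algebra isomorphism
`Γ(Y) ≃ Γ(X)` (★ `Alg.comap` is functorial), hence equal `R`-ranks. [cite: GortzWedhorn2020, Section (4.7)] -/
theorem AffineGroupScheme.Alg.finrank_eq_of_iso {R : Type u} [CommRing R] {X Y : SchemeOver R} (e : X ≅ Y) :
    Module.finrank R (Alg X) = Module.finrank R (Alg Y) := by
  have h1 : (Alg.comap e.inv).comp (Alg.comap e.hom) = AlgHom.id R (Alg Y) := by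
    rw [← Alg.comap_comp, Iso.inv_hom_id, Alg.comap_id]
  have h2 : (Alg.comap e.hom).comp (Alg.comap e.inv) = AlgHom.id R (Alg X) := by
    rw [← Alg.comap_comp, Iso.hom_inv_id, Alg.comap_id]
  exact (AlgEquiv.ofAlgHom (Alg.comap e.inv) (Alg.comap e.hom) h1 h2).toLinearEquiv.finrank_eq

/-- **Two subobjects with mutual factorisations are isomorphic over the ambient object**: monomorphisms `a : X ↪ M`, `b : Y ↪ M` with
`u ≫ b = a` and `v ≫ a = b` give an isomorphism `e : X ≅ Y` with `e.hom ≫ b = a`, `e.inv ≫ a = b`. [cite: GortzWedhorn2020, Definition 4.45 (2) (p. 117)] -/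
theorem exists_iso_of_fac_of_fac {C : Type u} [Category.{v} C] {X Y M : C} (a : X ⟶ M) (b : Y ⟶ M) [Mono a] [Mono b]
    (u : X ⟶ Y) (hu : u ≫ b = a) (v : Y ⟶ X) (hv : v ≫ a = b) : ∃ e : X ≅ Y, e.hom ≫ b = a ∧ e.inv ≫ a = b := by
  refine ⟨⟨u, v, ?_, ?_⟩, hu, hv⟩
  · rw [← cancel_mono a, Category.assoc, hv, hu, Category.id_comp]
  · rw [← cancel_mono b, Category.assoc, hu, hv, Category.id_comp]

namespace BTGroup

variable {k : Type u} [Field k] {p H : ℕ} (B : BTGroup (Spec (.of k)) p H) {𝒪 : Type v} [CommRing 𝒪]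
  (β : 𝒪 → BTGroup.Hom B B) (ϖ : 𝒪)

/-! ## §2 The filtration `K_i = Ker (β(ϖ^i) | B[p])` and its graded pieces -/

/-- `β(ϖ)` maps `K_{i+1} = Ker β(ϖ^{i+1})` into `K_i = Ker β(ϖ^i)` (inside the layer `B.G 1 = B[p]`): `ι_{K_{i+1}} ≫ β(ϖ) ≫ β(ϖ^i) = 1`, since
`β(ϖ) ≫ β(ϖ^i) = β(ϖ^{i+1})` (★ `IsRingActionBT.map_mul`). [cite: Tate1967, §2.2] -/
theorem kerι_powKer_comp_comp_eq_one (hβ : IsRingActionBT B β) (i : ℕ) :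
    letI := B.grpObj 1
    (kerι ((β (ϖ ^ (i + 1))).app 1) ≫ (β ϖ).app 1) ≫ (β (ϖ ^ i)).app 1 = 1 := by
  letI := B.grpObj 1
  rw [Category.assoc, ← BTGroup.Hom.comp_app, ← hβ.map_mul, ← pow_succ, kerι_comp]

/-- **A kernel with the points of `G` is `G`.**  Inside the layer `B.G 1`: if `ιG : G ↪ B.G 1` is a closed subgroup through which EXACTLY the
`T`-points killed by the endomorphism `φ` factor, then `Ker φ ≅ G` over `B.G 1` (both are subobjects with the same points: ★ `kerLift` and the
hypothesis give the two factorisations). [cite: GortzWedhorn2020, Definition 4.45 (2) (p. 117)] -/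
theorem exists_iso_ker_of_forall_comp_eq_one_iff (φ : letI := B.grpObj 1; B.G 1 ⟶ B.G 1) (G : SchemeOver k) (ιG : letI := B.grpObj 1; G ⟶ B.G 1) [Mono ιG]
    (hker : letI := B.grpObj 1; ∀ ⦃T : SchemeOver k⦄ (t : T ⟶ B.G 1), t ≫ φ = 1 ↔ ∃ s : T ⟶ G, s ≫ ιG = t) :
    letI := B.grpObj 1
    ∃ e : ker φ ≅ G, e.hom ≫ ιG = kerι φ ∧ e.inv ≫ kerι φ = ιG := by
  letI := B.grpObj 1
  haveI := mono_kerι φ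
  obtain ⟨u, hu⟩ := (hker (kerι φ)).mp (kerι_comp φ)
  have hιG : ιG ≫ φ = 1 := (hker ιG).mpr ⟨𝟙 G, Category.id_comp _⟩
  exact exists_iso_of_fac_of_fac (kerι φ) ιG u hu (kerLift ιG hιG) (kerLift_ι ιG hιG)

/-- **The graded piece: `Ker (β(ϖ) : K_{i+1} → K_i) ≅ G`** for the `[ϖ]`-kernel socket `ιG : G ↪ B.G 1` (a `T`-point of `K_{i+1}` killed by the
restriction `ρ` of `β(ϖ)` is a point of `B.G 1` killed by `β(ϖ)`, i.e. a point of `G`, and conversely `G ⊆ K_{i+1}` maps to `1` under `ρ`).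
[cite: Tate1967, §2.2] [cite: GortzWedhorn2020, Definition 4.45 (2) (p. 117)] -/
theorem exists_iso_ker_powKerRestrict (hβ : IsRingActionBT B β) (i : ℕ)
    (G : SchemeOver k) (ιG : letI := B.grpObj 1; G ⟶ B.G 1) [Mono ιG]
    (hker : letI := B.grpObj 1; ∀ ⦃T : SchemeOver k⦄ (t : T ⟶ B.G 1), t ≫ (β ϖ).app 1 = 1 ↔ ∃ s : T ⟶ G, s ≫ ιG = t)
    (ρ : letI := B.grpObj 1; ker ((β (ϖ ^ (i + 1))).app 1) ⟶ ker ((β (ϖ ^ i)).app 1))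
    (hρ : letI := B.grpObj 1; ρ ≫ kerι ((β (ϖ ^ i)).app 1) = kerι ((β (ϖ ^ (i + 1))).app 1) ≫ (β ϖ).app 1) :
    letI := B.grpObj 1
    haveI := (β (ϖ ^ i)).isMonHom_app 1
    ∃ e : ker ρ ≅ G, e.hom ≫ ιG = kerι ρ ≫ kerι ((β (ϖ ^ (i + 1))).app 1) := by
  letI := B.grpObj 1
  haveI := (β (ϖ ^ (i + 1))).isMonHom_app 1
  haveI := (β (ϖ ^ i)).isMonHom_app 1
  haveI := (β ϖ).isMonHom_app 1
  haveI := mono_kerι ((β (ϖ ^ (i + 1))).app 1)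
  haveI := mono_kerι ((β (ϖ ^ i)).app 1)
  haveI := mono_kerι ρ
  -- the composite inclusion `Ker ρ ↪ K_{i+1} ↪ B.G 1` is killed by `β(ϖ)`
  have ha : (kerι ρ ≫ kerι ((β (ϖ ^ (i + 1))).app 1)) ≫ (β ϖ).app 1 = 1 := by
    rw [Category.assoc, ← hρ, ← Category.assoc, kerι_comp, MonObj.one_comp]
  obtain ⟨u, hu⟩ := (hker _).mp ha
  -- conversely `G ⊆ K_{i+1}` and `ρ` kills it
  have hιG : ιG ≫ (β ϖ).app 1 = 1 := (hker ιG).mpr ⟨𝟙 G, Category.id_comp _⟩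
  have hιG' : ιG ≫ (β (ϖ ^ (i + 1))).app 1 = 1 := by
    rw [pow_succ, hβ.map_mul, BTGroup.Hom.comp_app, ← Category.assoc, hιG, MonObj.one_comp]
  have hw : kerLift ιG hιG' ≫ ρ = 1 := by
    rw [← cancel_mono (kerι ((β (ϖ ^ i)).app 1)), Category.assoc, hρ, ← Category.assoc, kerLift_ι, hιG, MonObj.one_comp]
  obtain ⟨e, he, -⟩ := exists_iso_of_fac_of_fac (kerι ρ ≫ kerι ((β (ϖ ^ (i + 1))).app 1)) ιG u hu
    (kerLift (kerLift ιG hιG') hw) (by rw [← Category.assoc, kerLift_ι, kerLift_ι])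
  exact ⟨e, he⟩

/-! ## §3 Faithful flatness of `β(ϖ) : K_{i+1} → K_i` for `i + 1 ≤ e` -/

/-- **`Γ(β(ϖ) : K_{i+1} → K_i)` IS INJECTIVE for `i + 1 ≤ e`** (`ϖ^e · u = p`): every `T`-point `x` of `K_i` lifts along `β(ϖ)` after the fppf
cover `T ×_{B[p]} B[p²] → T` (base change of `[p] : B[p²] ↠ B[p]`, ★ `flat_pMap`, `surjective_pMap`) — with `p z = x` put
`y := β(ϖ^i · c) z`, `ϖ^{i+1} c = p`; then `p y = β(c)(ϖ^i · x) = 0`, so `y ∈ B[p]` (★ `isPullback_incl`), `ϖ y = p z = x` and `ϖ^{i+1} y = ϖ^i x = 0`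
— and a function on `K_i` pulling back to `0` on `K_{i+1}` pulls back to `0` on the cover, hence is `0` (★ `comap_injective_of_flat_of_surjective`).
[cite: Tate1967, §2.2 and (2.4)] [cite: Waterhouse1979, §14.1] [cite: GortzWedhorn2020, Section (4.7)] -/
theorem comap_powKerRestrict_injective (hβ : IsRingActionBT B β) {e : ℕ} (hpe : Associated (ϖ ^ e) (p : 𝒪)) (i : ℕ) (hi : i + 1 ≤ e)
    (ρ : letI := B.grpObj 1; ker ((β (ϖ ^ (i + 1))).app 1) ⟶ ker ((β (ϖ ^ i)).app 1))
    (hρ : letI := B.grpObj 1; ρ ≫ kerι ((β (ϖ ^ i)).app 1) = kerι ((β (ϖ ^ (i + 1))).app 1) ≫ (β ϖ).app 1) :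
    Function.Injective (Alg.comap ρ) := by
  letI := B.grpObj 1
  letI := B.grpObj (1 + 1)
  haveI := (β (ϖ ^ (i + 1))).isMonHom_app 1
  haveI := (β (ϖ ^ i)).isMonHom_app 1
  haveI := (β (ϖ ^ i)).isMonHom_app (1 + 1)
  haveI := (β ϖ).isMonHom_app 1
  haveI := B.incl_isMonHom 1
  haveI := mono_kerι ((β (ϖ ^ (i + 1))).app 1)
  haveI := mono_kerι ((β (ϖ ^ i)).app 1)
  haveI := B.mono_incl 1
  -- the cofactor `c` with `ϖ^{i+1} · c = p`
  obtain ⟨c, hpc⟩ : ∃ c : 𝒪, ϖ ^ (i + 1) * c = (p : 𝒪) := by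
    obtain ⟨u, hu⟩ := hpe
    exact ⟨ϖ ^ (e - (i + 1)) * ↑u, by rw [← mul_assoc, ← pow_add, Nat.add_sub_cancel' hi, hu]⟩
  have hw : ϖ * (ϖ ^ i * c) = (p : 𝒪) := by rw [← mul_assoc, ← pow_succ', hpc]
  have hw' : ϖ ^ (i + 1) * (ϖ ^ i * c) = ϖ ^ i * (p : 𝒪) := by rw [mul_left_comm, hpc]
  haveI := (β c).isMonHom_app 1
  haveI := (β (ϖ ^ i * c)).isMonHom_app (1 + 1)
  -- `[p]` on `B.G 2` is `pMap ≫ incl` and is `β p`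
  have hp2 : (β (p : 𝒪)).app (1 + 1) = B.pMap 1 ≫ B.incl 1 := by rw [hβ.app_natCast, B.pMap_incl]
  have hx1 : kerι ((β (ϖ ^ i)).app 1) ≫ (β (ϖ ^ i * c)).app 1 = 1 := by
    rw [mul_comm (ϖ ^ i) c, hβ.map_mul, BTGroup.Hom.comp_app, ← Category.assoc, kerι_comp, MonObj.one_comp]
  -- the fppf cover `P := K_i ×_{B.G 1} B.G 2 → K_i`
  obtain ⟨P, f₁, f₂, hcond, sq⟩ : ∃ (P : SchemeOver k) (f₁ : P ⟶ ker ((β (ϖ ^ i)).app 1)) (f₂ : P ⟶ B.G (1 + 1)),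
      f₁ ≫ kerι ((β (ϖ ^ i)).app 1) = f₂ ≫ B.pMap 1 ∧
        IsPullback f₂.left f₁.left (B.pMap 1).left (kerι ((β (ϖ ^ i)).app 1)).left :=
    ⟨_, _, _, pullback.condition, ((IsPullback.of_hasPullback (kerι ((β (ϖ ^ i)).app 1)) (B.pMap 1)).map (Over.forget _)).flip⟩
  -- the lift `y : P → B.G 1` of `f₂ ≫ β(ϖ^i c)` through `incl 1`
  have hy₂ : (f₂ ≫ (β (ϖ ^ i * c)).app (1 + 1)) ≫ (𝟙 (B.G (1 + 1))) ^ (p ^ 1) = toUnit P ≫ η[B.G (1 + 1)] := by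
    rw [pow_one, ← hβ.app_natCast p (1 + 1), Category.assoc, ← BTGroup.Hom.comp_app, ← hβ.map_mul,
      mul_comm (p : 𝒪) (ϖ ^ i * c), hβ.map_mul, BTGroup.Hom.comp_app, hp2, ← Category.assoc, ← Category.assoc, ← hcond,
      Category.assoc, Category.assoc, (β (ϖ ^ i * c)).incl_comp_app 1,
      ← Category.assoc (kerι ((β (ϖ ^ i)).app 1)) ((β (ϖ ^ i * c)).app 1) (B.incl 1), hx1, MonObj.one_comp, MonObj.comp_one,
      Hom.one_def]
  obtain ⟨y, hy⟩ : ∃ y : P ⟶ B.G 1, y ≫ B.incl 1 = f₂ ≫ (β (ϖ ^ i * c)).app (1 + 1) :=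
    ⟨(B.isPullback_incl 1).lift _ (toUnit P) hy₂, (B.isPullback_incl 1).lift_fst _ (toUnit P) hy₂⟩
  -- `y` is a point of `K_{i+1}`
  have hyK : y ≫ (β (ϖ ^ (i + 1))).app 1 = 1 := by
    rw [← cancel_mono (B.incl 1), Category.assoc, ← (β (ϖ ^ (i + 1))).incl_comp_app 1, ← Category.assoc, hy, Category.assoc,
      ← BTGroup.Hom.comp_app, ← hβ.map_mul, hw', hβ.map_mul, BTGroup.Hom.comp_app, hp2, ← Category.assoc, ← Category.assoc, ← hcond,
      Category.assoc, Category.assoc, (β (ϖ ^ i)).incl_comp_app 1,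
      ← Category.assoc (kerι ((β (ϖ ^ i)).app 1)) ((β (ϖ ^ i)).app 1) (B.incl 1), kerι_comp, MonObj.one_comp, MonObj.comp_one,
      MonObj.one_comp]
  -- `s := kerLift y : P → K_{i+1}` has `s ≫ ρ = f₁`
  have hs : kerLift y hyK ≫ ρ = f₁ := by
    rw [← cancel_mono (kerι ((β (ϖ ^ i)).app 1)), Category.assoc, hρ, ← Category.assoc, kerLift_ι, ← cancel_mono (B.incl 1),
      Category.assoc, ← (β ϖ).incl_comp_app 1, ← Category.assoc, hy, Category.assoc, ← BTGroup.Hom.comp_app, ← hβ.map_mul, hw, hp2,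
      ← Category.assoc, ← hcond, Category.assoc]
  -- `f₁` is flat, surjective and affine (base change of `pMap`), so it pulls back functions injectively
  haveI : Flat f₁.left := MorphismProperty.IsStableUnderBaseChange.of_isPullback sq (B.flat_pMap 1)
  haveI : Surjective f₁.left := MorphismProperty.IsStableUnderBaseChange.of_isPullback sq (B.surjective_pMap 1)
  haveI := B.isFinite 1
  haveI := B.isFinite (1 + 1)
  haveI : IsAffine (B.G 1).left := isAffine_of_isAffineHom (B.G 1).hom
  haveI : IsClosedImmersion (kerι ((β (ϖ ^ i)).app 1)).left := isClosedImmersion_kerι_left_of_isSeparated _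
  haveI : IsAffine (ker ((β (ϖ ^ i)).app 1)).left := isAffine_of_isAffineHom (kerι ((β (ϖ ^ i)).app 1)).left
  haveI : IsAffineHom (B.pMap 1).left := by
    haveI : IsAffineHom ((B.pMap 1).left ≫ (B.G 1).hom) := by rw [Over.w (B.pMap 1)]; infer_instance
    exact IsAffineHom.of_comp (B.pMap 1).left (B.G 1).hom
  haveI : IsAffineHom f₁.left := MorphismProperty.IsStableUnderBaseChange.of_isPullback sq inferInstance
  haveI : IsAffine P.left := isAffine_of_isAffineHom f₁.left
  have hinj := comap_injective_of_flat_of_surjective f₁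
  rw [← hs, Alg.comap_comp] at hinj
  exact Function.Injective.of_comp hinj

/-! ## §4 Ranks -/

/-- **`rk K_{i+1} = (rk G)^{i+1}` for `i + 1 ≤ e`** (`K_j = Ker (β(ϖ^j) | B[p])`, `G` the `[ϖ]`-kernel socket): `K_1 ≅ G`, and for `i + 2 ≤ e` the
faithfully flat `β(ϖ) : K_{i+2} → K_{i+1}` with kernel `≅ G` gives `rk K_{i+2} = rk G · rk K_{i+1}` (★ `finrank_alg_ker_mul_finrank`).
[cite: Tate1967, §2.2 and (2.4)] [cite: Montgomery1993Hopf, Corollary 3.2.1 (p. 30)] [cite: Waterhouse1979, §14.1] -/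
theorem finrank_alg_powKer_eq_pow (hβ : IsRingActionBT B β) {e : ℕ} (hpe : Associated (ϖ ^ e) (p : 𝒪))
    (G : SchemeOver k) [GrpObj G] (ιG : letI := B.grpObj 1; G ⟶ B.G 1)
    (hιG : letI := B.grpObj 1; IsMonHom ιG ∧ IsClosedImmersion ιG.left)
    (hker : letI := B.grpObj 1; ∀ ⦃T : SchemeOver k⦄ (t : T ⟶ B.G 1), t ≫ (β ϖ).app 1 = 1 ↔ ∃ s : T ⟶ G, s ≫ ιG = t)
    (i : ℕ) (hi : i + 1 ≤ e) :
    letI := B.grpObj 1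
    Module.finrank k (Alg (ker ((β (ϖ ^ (i + 1))).app 1))) = Module.finrank k (Alg G) ^ (i + 1) := by
  letI := B.grpObj 1
  haveI := hιG.2
  haveI : Mono ιG := Over.mono_of_mono_left ιG
  haveI := B.isFinite 1
  haveI : IsAffine (B.G 1).left := isAffine_of_isAffineHom (B.G 1).hom
  -- every `K_j` is an affine finite `k`-scheme
  have hKaff : ∀ j : ℕ, IsAffine (ker ((β (ϖ ^ j)).app 1)).left ∧ IsFinite (ker ((β (ϖ ^ j)).app 1)).hom := fun j => by
    haveI : IsClosedImmersion (kerι ((β (ϖ ^ j)).app 1)).left := isClosedImmersion_kerι_left_of_isSeparated _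
    refine ⟨isAffine_of_isAffineHom (kerι ((β (ϖ ^ j)).app 1)).left, ?_⟩
    rw [← Over.w (kerι ((β (ϖ ^ j)).app 1))]; infer_instance
  induction i with
  | zero =>
    -- `K_1 ≅ G`
    haveI := (β (ϖ ^ (0 + 1))).isMonHom_app 1
    have hker' : ∀ ⦃T : SchemeOver k⦄ (t : T ⟶ B.G 1), t ≫ (β (ϖ ^ (0 + 1))).app 1 = 1 ↔ ∃ s : T ⟶ G, s ≫ ιG = t := by
      simpa only [zero_add, pow_one] using hker
    obtain ⟨e₁, -, -⟩ := B.exists_iso_ker_of_forall_comp_eq_one_iff ((β (ϖ ^ (0 + 1))).app 1) G ιG hker'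
    rw [Alg.finrank_eq_of_iso e₁, zero_add, pow_one]
  | succ i ih =>
    haveI := (β (ϖ ^ (i + 1 + 1))).isMonHom_app 1
    haveI := (β (ϖ ^ (i + 1))).isMonHom_app 1
    haveI := (β ϖ).isMonHom_app 1
    haveI := (hKaff (i + 1 + 1)).1
    haveI := (hKaff (i + 1)).1
    haveI : Module.Finite k (Alg (ker ((β (ϖ ^ (i + 1 + 1))).app 1))) := by
      haveI := (hKaff (i + 1 + 1)).2; exact Alg.moduleFinite _
    -- the restriction `ρ : K_{i+2} → K_{i+1}` of `β(ϖ)`: faithfully flat with kernel `≅ G`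
    have hρ : kerLift (kerι ((β (ϖ ^ (i + 1 + 1))).app 1) ≫ (β ϖ).app 1) (B.kerι_powKer_comp_comp_eq_one β ϖ hβ (i + 1)) ≫
        kerι ((β (ϖ ^ (i + 1))).app 1) = kerι ((β (ϖ ^ (i + 1 + 1))).app 1) ≫ (β ϖ).app 1 := kerLift_ι _ _
    haveI : IsMonHom (kerLift (kerι ((β (ϖ ^ (i + 1 + 1))).app 1) ≫ (β ϖ).app 1)
        (B.kerι_powKer_comp_comp_eq_one β ϖ hβ (i + 1))) := isMonHom_kerLift _ _
    have hinj := B.comap_powKerRestrict_injective β ϖ hβ hpe (i + 1) hi _ hρ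
    obtain ⟨eK, -⟩ := B.exists_iso_ker_powKerRestrict β ϖ hβ (i + 1) G ιG hker _ hρ
    rw [← finrank_alg_ker_mul_finrank _ hinj, Alg.finrank_eq_of_iso eK, ih (Nat.le_of_succ_le hi), ← pow_succ']

/-- **`(rk_k Γ(G))^e = p^H` — THE `ϖ`-TORSION RANK OF A BARSOTTI–TATE GROUP WITH `𝒪`-ACTION.**  `B` a Barsotti–Tate group of height `H` over a
field `k`, `β : 𝒪 → End B` a ring action, `ϖ ∈ 𝒪` with `ϖ^e ∼ p` (`e ≥ 1`), `ιG : G ↪ B.G 1` a closed subgroup through which EXACTLY the `T`-points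
killed by `β(ϖ)` factor (all `T`).  Then `(rk_k Γ(G))^e = p^H`: `rk K_e = (rk G)^e` (previous theorem) and `K_e = Ker β(ϖ^e) = Ker [p]·β(u⁻¹)… = B[p]`
has rank `p^H` (★ `BTGroup.killed`, `BTGroup.finrank_eq`, ★ `finrank_alg_eq_finrank_hom`). [cite: Tate1967, §2.2 and (2.4)] [cite: HarrisTaylorAMS2001, §II.1 (p. 59)] -/
theorem finrank_alg_uniformizerKernel_pow_eq (hβ : IsRingActionBT B β) {e : ℕ} (he : 0 < e) (hpe : Associated (ϖ ^ e) (p : 𝒪))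
    (G : SchemeOver k) [GrpObj G] (ιG : letI := B.grpObj 1; G ⟶ B.G 1)
    (hιG : letI := B.grpObj 1; IsMonHom ιG ∧ IsClosedImmersion ιG.left)
    (hker : letI := B.grpObj 1; ∀ ⦃T : SchemeOver k⦄ (t : T ⟶ B.G 1), t ≫ (β ϖ).app 1 = 1 ↔ ∃ s : T ⟶ G, s ≫ ιG = t) :
    Module.finrank k (Alg G) ^ e = p ^ H := by
  letI := B.grpObj 1
  obtain ⟨e, rfl⟩ : ∃ e', e = e' + 1 := ⟨e - 1, (Nat.sub_add_cancel he).symm⟩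
  rw [← B.finrank_alg_powKer_eq_pow β ϖ hβ hpe G ιG hιG hker e le_rfl]
  -- `β(ϖ^{e}) = [p] ≫ β(u⁻¹) = 1` on `B.G 1`, so `K_e ≅ B.G 1`
  haveI := (β (ϖ ^ (e + 1))).isMonHom_app 1
  haveI := mono_kerι ((β (ϖ ^ (e + 1))).app 1)
  obtain ⟨u, hu⟩ := hpe
  haveI := (β (↑u⁻¹ : 𝒪)).isMonHom_app 1
  have h1 : (β (ϖ ^ (e + 1))).app 1 = 1 := by
    have hϖ : ϖ ^ (e + 1) = (p : 𝒪) * ↑u⁻¹ := by rw [← hu, mul_assoc, Units.mul_inv, mul_one]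
    have hk : (𝟙 (B.G 1)) ^ p = 1 := by simpa only [pow_one] using B.killed 1
    rw [hϖ, hβ.map_mul, BTGroup.Hom.comp_app, hβ.app_natCast, hk, MonObj.comp_one]
  obtain ⟨eM, -, -⟩ := exists_iso_of_fac_of_fac (kerι ((β (ϖ ^ (e + 1))).app 1)) (𝟙 (B.G 1)) (kerι _) (Category.comp_id _)
    (kerLift (𝟙 (B.G 1)) (by rw [h1, MonObj.comp_one])) (kerLift_ι _ _)
  haveI := B.isFinite 1
  haveI := B.flat 1
  rw [Alg.finrank_eq_of_iso eM, finrank_alg_eq_finrank_hom (B.G 1) (IsLocalRing.closedPoint k), B.finrank_eq 1, one_mul]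

/-- **`rk_k Γ(B[ϖ]) = p^f · p^f` when `H = 2·e·f`** — the statement of `stub_N0_finrank_uniformizerKernel` of the P6b sub-line
`Lines/F0_P6b_BlockNumerics.lean` (desk F0P6b-plan (g2)), closer-grade: with `𝒪 = 𝒪_{F,w}` of ramification index `e` and residue degree `f`,
`ϖ^e ∼ p`, a `w`-block of `𝒪`-height `2` has height `H = 2ef` and `ϖ`-torsion of rank `q² = (p^f)²`.  (`k` need not be algebraically closed;
`𝒪` any commutative ring.) [cite: Tate1967, §2.2 and (2.4)] [cite: HarrisTaylorAMS2001, §II.1 (p. 59)] -/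
theorem finrank_alg_uniformizerKernel (hβ : IsRingActionBT B β) (e f : ℕ) (he : 0 < e) (hH : H = 2 * e * f)
    (hpe : Associated (ϖ ^ e) (p : 𝒪))
    (G : SchemeOver k) [GrpObj G] (ιG : letI := B.grpObj 1; G ⟶ B.G 1)
    (hιG : letI := B.grpObj 1; IsMonHom ιG ∧ IsClosedImmersion ιG.left)
    (hker : letI := B.grpObj 1; ∀ ⦃T : SchemeOver k⦄ (t : T ⟶ B.G 1), t ≫ (β ϖ).app 1 = 1 ↔ ∃ s : T ⟶ G, s ≫ ιG = t) :
    Module.finrank k (Alg G) = p ^ f * p ^ f := by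
  have h := B.finrank_alg_uniformizerKernel_pow_eq β ϖ hβ he hpe G ιG hιG hker
  have h' : (p ^ f * p ^ f) ^ e = p ^ H := by
    rw [hH, ← pow_add, ← pow_mul]; congr 1; ring
  exact Nat.pow_left_injective (Nat.pos_iff_ne_zero.mp he) (h.trans h'.symm)

end BTGroup

end Literature.AlgebraicGeometry.GroupSchemes

end
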